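import Literature.Geometry.Lorentzian.KerrDeSitterMasterEquations
import HarnessLib

/-!
# The rotation-reversal symmetry `(a, m) ↦ (−a, −m)` of the separated Teukolsky / master system on
# Kerr–de Sitter (theorems only)

Theorems only (no named facts, no new definitions). The printed separated equations — the angular
equation [CasalsTeixeiradacosta2022, (3.6)] (= [Hatsuda2020, (2.5)]) and the radial equation
[CasalsTeixeiradacosta2022, (3.8)] (= [SuzukiTakasugiUmetsu1998, (3.7)]) with the boundary
conditions of [CasalsTeixeiradacosta2022, Definition 3.3/3.4] — are invariant under reversing the
sense of rotation together with the azimuthal number and the polar angle,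
`(a, m, x = cos θ) ↦ (−a, −m, −x)` (`ν = aω ↦ −ν`): every coefficient depends on `a` through `a²`,
`am`, `aω·m`, `aω·sx`, `smx` and `(m + sx)²` only. Consequently the horizon function, the radii
`r₋, r₊, r_c`, subextremality, `K = ω(r²+a²) − am`, the horizon exponents and the radial equation are
literally unchanged, while an angular eigenfunction `S(x)` for `(a, m)` gives the eigenfunction
`S(−x)` for `(−a, −m)` with the same separation constant (the pole exponents `|m ∓ s|/2` swap).

This is the symmetry by which statements made for `a ≥ 0` (the printed superradiant intervals
`(ϖ₂, ϖ₁)·m`, `|m|(0, Ω_SR)` presuppose `a ≥ 0`; the tree's named facts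
`CasalsTeixeiraDaCosta2022_partialModeStability` / `…Prop38` carry the binder `0 ≤ a` with the remark
"`a < 0` is the image under `(a, m) ↦ (−a, −m)`") transfer to `a < 0`. Results (namespace
`Literature.Geometry.Lorentzian.KerrDeSitter`):

* evenness in `a`: `xi_neg`, `alpha_neg`, `delta_neg`, `deltaDeriv_neg`, `rCosmo_neg`, `rPlus_neg`,
  `rMinus_neg`, `isSubextremal_neg_iff`;
* radial data: `radialK_neg`, `horizonB_neg`, `radialPotential_neg`, `masterRadialPotential_neg`,
  `isRadialTeukolskySolution_neg_iff`, `isMasterRadialSolution_neg_iff`,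
  `isIngoingAtEventHorizon_neg_iff`, `isOutgoingAtCosmoHorizon_neg_iff` (same radial function);
* angular data: `angularPotential_neg`, `masterAngularPotential_neg` (at `−x`),
  `isAngularTeukolskySolution_reflect`, `isMasterAngularSolution_reflect`, `isRegularAtPoles_reflect`
  (`S ↦ S ∘ (−·)`), `isAngularEigenvalue_neg_iff`, `isMasterAngularEigenvalue_neg_iff`;
* modes: `hasMode_neg_iff : HasMode M (−a) Λ s ω (−m) ↔ HasMode M a Λ s ω m`,
  `hasMasterMode_neg_iff`, and for `2s ∈ ℤ` (so that `m − s ∈ ℤ ↔ −m − s ∈ ℤ`):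
  ★ `modeStable_neg_iff : ModeStable M (−a) Λ s ↔ ModeStable M a Λ s`,
  `masterModeStable_neg_iff`, `noModeIn_neg_iff` (window reflected in `m`), `modeStableOn_neg`.

## References
* M. Casals, R. Teixeira da Costa, Commun. Math. Phys. 394 (2022) 797–832, arXiv:2105.13329 v3,
  (3.6), (3.8), Definitions 3.3–3.4. [CasalsTeixeiradacosta2022]
* Y. Hatsuda, Class. Quantum Grav. 38 (2020) 025015, (2.5), (2.13)–(2.18). [Hatsuda2020]
-/

noncomputable section

open Complex Set Filter Topology

namespace Literature.Geometry.Lorentzian.KerrDeSitter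

/-! ### Evenness in `a` of the background data -/

/-- `Ξ(−a) = Ξ(a)`. [cite: SuzukiTakasugiUmetsu1998, (2.2)] -/
@[simp] theorem xi_neg (a Λ : ℝ) : xi (-a) Λ = xi a Λ := by simp [xi]

/-- `α(−a) = α(a)`. [cite: SuzukiTakasugiUmetsu1998, (2.2)] -/
@[simp] theorem alpha_neg (a Λ : ℝ) : alpha (-a) Λ = alpha a Λ := by simp [alpha]

/-- `Δ_r` is even in `a`. [cite: Hatsuda2020, (2.13)] -/
@[simp] theorem delta_neg (M a Λ r : ℝ) : delta M (-a) Λ r = delta M a Λ r := by simp [delta]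

/-- `Δ_r'` is even in `a`. [cite: Hatsuda2020, (2.13)] -/
@[simp] theorem deltaDeriv_neg (M a Λ r : ℝ) : deltaDeriv M (-a) Λ r = deltaDeriv M a Λ r := by
  simp [deltaDeriv]

/-- `r_c(−a) = r_c(a)`. [cite: CasalsTeixeiradacosta2022, (3.2)] -/
@[simp] theorem rCosmo_neg (M a Λ : ℝ) : rCosmo M (-a) Λ = rCosmo M a Λ := by
  simp only [rCosmo, delta_neg]

/-- `r₊(−a) = r₊(a)`. [cite: CasalsTeixeiradacosta2022, (3.2)] -/
@[simp] theorem rPlus_neg (M a Λ : ℝ) : rPlus M (-a) Λ = rPlus M a Λ := by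
  simp only [rPlus, rCosmo_neg, delta_neg]

/-- `r₋(−a) = r₋(a)`. [cite: CasalsTeixeiradacosta2022, (3.2)] -/
@[simp] theorem rMinus_neg (M a Λ : ℝ) : rMinus M (-a) Λ = rMinus M a Λ := by
  simp only [rMinus, delta_neg]

/-- Subextremality is insensitive to the sense of rotation. [cite: CasalsTeixeiradacosta2022, (3.1)] -/
theorem isSubextremal_neg_iff (M a Λ : ℝ) : IsSubextremal M (-a) Λ ↔ IsSubextremal M a Λ := by
  simp only [IsSubextremal, delta_neg, rMinus_neg, rPlus_neg, rCosmo_neg]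

/-! ### The radial data under `(a, m) ↦ (−a, −m)` -/

/-- `K(r) = ω(r²+a²) − am` is invariant under `(a, m) ↦ (−a, −m)`. [cite: Hatsuda2020, (2.14)] -/
@[simp] theorem radialK_neg (a : ℝ) (ω : ℂ) (m : ℝ) (r : ℝ) :
    radialK (-a) ω (-m) r = radialK a ω m r := by
  simp [radialK]

/-- The horizon exponents are invariant under `(a, m) ↦ (−a, −m)`. [cite: Hatsuda2020, (2.18)] -/
@[simp] theorem horizonB_neg (M a Λ : ℝ) (ω : ℂ) (m : ℝ) (rh : ℝ) :
    horizonB M (-a) Λ ω (-m) rh = horizonB M a Λ ω m rh := by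
  simp [horizonB]

/-- The radial Teukolsky coefficient (STU (3.7) / Hatsuda (2.13)) is invariant under
`(a, m) ↦ (−a, −m)`. [cite: SuzukiTakasugiUmetsu1998, (3.7)] -/
@[simp] theorem radialPotential_neg (M a Λ s : ℝ) (ω : ℂ) (m : ℝ) (lam : ℂ) (r : ℝ) :
    radialPotential M (-a) Λ s ω (-m) lam r = radialPotential M a Λ s ω m lam r := by
  simp [radialPotential]

/-- The radial master coefficient (CTdC (3.8), any `μ`) is invariant under `(a, m) ↦ (−a, −m)`
(`2Ξ²amω` and `a²Ξ²ω²` are). [cite: CasalsTeixeiradacosta2022, (3.8)] -/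
@[simp] theorem masterRadialPotential_neg (M a Λ s μ : ℝ) (ω : ℂ) (m : ℝ) (lamBar : ℂ) (r : ℝ) :
    masterRadialPotential M (-a) Λ s μ ω (-m) lamBar r =
      masterRadialPotential M a Λ s μ ω m lamBar r := by
  simp only [masterRadialPotential, radialK_neg, xi_neg, delta_neg, deltaDeriv_neg]
  push_cast
  ring

/-- Radial Teukolsky solutions for `(−a, −m)` are those for `(a, m)` (same function).
[cite: SuzukiTakasugiUmetsu1998, (3.7)] -/
theorem isRadialTeukolskySolution_neg_iff (M a Λ s : ℝ) (ω : ℂ) (m : ℝ) (lam : ℂ) (R : ℝ → ℂ) :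
    IsRadialTeukolskySolution M (-a) Λ s ω (-m) lam R ↔ IsRadialTeukolskySolution M a Λ s ω m lam R := by
  simp only [IsRadialTeukolskySolution, radialPotential_neg, delta_neg, deltaDeriv_neg, rPlus_neg,
    rCosmo_neg]

/-- Radial master solutions for `(−a, −m)` are those for `(a, m)` (same function, any `μ`).
[cite: CasalsTeixeiradacosta2022, (3.8)] -/
theorem isMasterRadialSolution_neg_iff (M a Λ s μ : ℝ) (ω : ℂ) (m : ℝ) (lamBar : ℂ) (R : ℝ → ℂ) :
    IsMasterRadialSolution M (-a) Λ s μ ω (-m) lamBar R ↔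
      IsMasterRadialSolution M a Λ s μ ω m lamBar R := by
  simp only [IsMasterRadialSolution, masterRadialPotential_neg, delta_neg, deltaDeriv_neg, rPlus_neg,
    rCosmo_neg]

/-- "Ingoing at `𝓗⁺`" is invariant under `(a, m) ↦ (−a, −m)`. [cite: CasalsTeixeiradacosta2022, Definition 3.3] -/
theorem isIngoingAtEventHorizon_neg_iff (M a Λ s : ℝ) (ω : ℂ) (m : ℝ) (R : ℝ → ℂ) :
    IsIngoingAtEventHorizon M (-a) Λ s ω (-m) R ↔ IsIngoingAtEventHorizon M a Λ s ω m R := by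
  simp only [IsIngoingAtEventHorizon, rPlus_neg, horizonB_neg]

/-- "Outgoing at `𝓗⁺_c`" is invariant under `(a, m) ↦ (−a, −m)`. [cite: CasalsTeixeiradacosta2022, Definition 3.3] -/
theorem isOutgoingAtCosmoHorizon_neg_iff (M a Λ : ℝ) (ω : ℂ) (m : ℝ) (R : ℝ → ℂ) :
    IsOutgoingAtCosmoHorizon M (-a) Λ ω (-m) R ↔ IsOutgoingAtCosmoHorizon M a Λ ω m R := by
  simp only [IsOutgoingAtCosmoHorizon, rCosmo_neg, horizonB_neg]

/-! ### The angular data under `(a, m, x) ↦ (−a, −m, −x)` -/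

/-- The angular Teukolsky coefficient (Hatsuda (2.5)) satisfies `V_{−a,−m}(−x) = V_{a,m}(x)`.
[cite: Hatsuda2020, (2.5)] -/
theorem angularPotential_neg (a Λ s : ℝ) (ω : ℂ) (m : ℝ) (lam : ℂ) (x : ℝ) :
    angularPotential (-a) Λ s ω (-m) lam (-x) = angularPotential a Λ s ω m lam x := by
  simp only [angularPotential, alpha_neg]
  have e1 : ((-m) + s * (-x)) ^ 2 = (m + s * x) ^ 2 := by ring
  have e2 : (-x) ^ 2 = x ^ 2 := by ring
  rw [e1, e2]
  push_cast
  ring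

/-- The angular master coefficient (CTdC (3.6), any `μ`, parameter `ν`) satisfies
`V_{−a,−ν,−m}(−x) = V_{a,ν,m}(x)`. [cite: CasalsTeixeiradacosta2022, (3.6)] -/
theorem masterAngularPotential_neg (a Λ s μ : ℝ) (ν : ℂ) (m : ℝ) (lamBar : ℂ) (x : ℝ) :
    masterAngularPotential (-a) Λ s μ (-ν) (-m) lamBar (-x) =
      masterAngularPotential a Λ s μ ν m lamBar x := by
  simp only [masterAngularPotential, alpha_neg, xi_neg]
  have e1 : (xi a Λ * (-m) + s * (-x) * (xi a Λ - 2 * alpha a Λ * (1 - (-x) ^ 2))) ^ 2 =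
      (xi a Λ * m + s * x * (xi a Λ - 2 * alpha a Λ * (1 - x ^ 2))) ^ 2 := by ring
  have e2 : (-x) ^ 2 = x ^ 2 := by ring
  rw [e1, e2]
  push_cast
  ring

/-- Reflecting an angular Teukolsky solution: if `S` solves the `(a, m)` equation on `(−1, 1)` then
`x ↦ S(−x)` solves the `(−a, −m)` equation (the weight `(1+αx²)(1−x²)` is even, the first-order
coefficient odd). [cite: Hatsuda2020, (2.5)] -/
theorem isAngularTeukolskySolution_reflect {a Λ s : ℝ} {ω : ℂ} {m : ℝ} {lam : ℂ} {S : ℝ → ℂ}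
    (h : IsAngularTeukolskySolution a Λ s ω m lam S) :
    IsAngularTeukolskySolution (-a) Λ s ω (-m) lam (fun x => S (-x)) := by
  obtain ⟨S', S'', hS⟩ := h
  refine ⟨fun x => -S' (-x), fun x => S'' (-x), fun x hx => ?_⟩
  have hx' : -x ∈ Ioo (-1 : ℝ) 1 := ⟨by linarith [hx.2], by linarith [hx.1]⟩
  obtain ⟨h1, h2, hode⟩ := hS (-x) hx'
  refine ⟨?_, ?_, ?_⟩
  · have hd := h1.scomp x (hasDerivAt_neg x)
    simp only [Function.comp_def, neg_one_smul] at hd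
    exact hd
  · have h2' := h2.scomp x (hasDerivAt_neg x)
    simp only [Function.comp_def, neg_one_smul] at h2'
    have h2'' := h2'.neg
    simp only [neg_neg] at h2''
    exact h2''
  · rw [← angularPotential_neg a Λ s ω m lam (-x)] at hode
    simp only [neg_neg] at hode
    have e1 : (((1 + alpha a Λ * (-x) ^ 2) * (1 - (-x) ^ 2) : ℝ) : ℂ) =
        (((1 + alpha (-a) Λ * x ^ 2) * (1 - x ^ 2) : ℝ) : ℂ) := by
      rw [alpha_neg]; push_cast; ring
    have e2 : ((2 * (alpha a Λ - 1) * (-x) - 4 * alpha a Λ * (-x) ^ 3 : ℝ) : ℂ) =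
        -((2 * (alpha (-a) Λ - 1) * x - 4 * alpha (-a) Λ * x ^ 3 : ℝ) : ℂ) := by
      rw [alpha_neg]; push_cast; ring
    rw [e1, e2] at hode
    linear_combination hode

/-- Reflecting an angular master solution (any `μ`, parameter `ν ↦ −ν`). [cite: CasalsTeixeiradacosta2022, (3.6)] -/
theorem isMasterAngularSolution_reflect {a Λ s μ : ℝ} {ν : ℂ} {m : ℝ} {lamBar : ℂ} {S : ℝ → ℂ}
    (h : IsMasterAngularSolution a Λ s μ ν m lamBar S) :
    IsMasterAngularSolution (-a) Λ s μ (-ν) (-m) lamBar (fun x => S (-x)) := by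
  obtain ⟨S', S'', hS⟩ := h
  refine ⟨fun x => -S' (-x), fun x => S'' (-x), fun x hx => ?_⟩
  have hx' : -x ∈ Ioo (-1 : ℝ) 1 := ⟨by linarith [hx.2], by linarith [hx.1]⟩
  obtain ⟨h1, h2, hode⟩ := hS (-x) hx'
  refine ⟨?_, ?_, ?_⟩
  · have hd := h1.scomp x (hasDerivAt_neg x)
    simp only [Function.comp_def, neg_one_smul] at hd
    exact hd
  · have h2' := h2.scomp x (hasDerivAt_neg x)
    simp only [Function.comp_def, neg_one_smul] at h2'
    have h2'' := h2'.neg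
    simp only [neg_neg] at h2''
    exact h2''
  · rw [← masterAngularPotential_neg a Λ s μ ν m lamBar (-x)] at hode
    simp only [neg_neg] at hode
    have e1 : (((1 + alpha a Λ * (-x) ^ 2) * (1 - (-x) ^ 2) : ℝ) : ℂ) =
        (((1 + alpha (-a) Λ * x ^ 2) * (1 - x ^ 2) : ℝ) : ℂ) := by
      rw [alpha_neg]; push_cast; ring
    have e2 : ((2 * (alpha a Λ - 1) * (-x) - 4 * alpha a Λ * (-x) ^ 3 : ℝ) : ℂ) =
        -((2 * (alpha (-a) Λ - 1) * x - 4 * alpha (-a) Λ * x ^ 3 : ℝ) : ℂ) := by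
      rw [alpha_neg]; push_cast; ring
    rw [e1, e2] at hode
    linear_combination hode

/-- Reflecting the pole conditions: if `S` is the regular branch for `(s, m)` at both poles then
`x ↦ S(−x)` is the regular branch for `(s, −m)` (exponents `|m ∓ s|/2` swap: `|−m − s| = |m + s|`,
`|−m + s| = |m − s|`). [cite: CasalsTeixeiradacosta2022, Lemma 3.1] -/
theorem isRegularAtPoles_reflect {s m : ℝ} {S : ℝ → ℂ} (h : IsRegularAtPoles s m S) :
    IsRegularAtPoles s (-m) (fun x => S (-x)) := by
  obtain ⟨⟨ε₁, hε₁, g₁, hg₁, hS₁⟩, ⟨ε₂, hε₂, g₂, hg₂, hS₂⟩⟩ := h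
  have hneg : ∀ (U : Set ℝ), ContDiffOn ℝ ((⊤ : ℕ∞) : WithTop ℕ∞) (fun x : ℝ => -x) U :=
    fun U => contDiff_neg.contDiffOn
  constructor
  · -- left pole of the reflected function = right pole of `S`
    refine ⟨ε₂, hε₂, fun x => g₂ (-x), ?_, fun x hx => ?_⟩
    · refine hg₂.comp (hneg _) fun x hx => ?_
      exact ⟨by linarith [hx.2], by linarith [hx.1]⟩
    · have hx' : -x ∈ Ioo (1 - ε₂) (1 : ℝ) := ⟨by linarith [hx.2], by linarith [hx.1]⟩
      have e : |(-m) - s| = |m + s| := by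
        rw [show (-m) - s = -(m + s) by ring, abs_neg]
      beta_reduce
      rw [hS₂ (-x) hx', e, sub_neg_eq_add]
  · -- right pole of the reflected function = left pole of `S`
    refine ⟨ε₁, hε₁, fun x => g₁ (-x), ?_, fun x hx => ?_⟩
    · refine hg₁.comp (hneg _) fun x hx => ?_
      exact ⟨by linarith [hx.2], by linarith [hx.1]⟩
    · have hx' : -x ∈ Ioo (-1 : ℝ) (-1 + ε₁) := ⟨by linarith [hx.2], by linarith [hx.1]⟩
      have e : |(-m) + s| = |m - s| := by
        rw [show (-m) + s = -(m - s) by ring, abs_neg]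
      have e' : ((1 + -x : ℝ) : ℂ) = ((1 - x : ℝ) : ℂ) := by push_cast; ring
      beta_reduce
      rw [hS₁ (-x) hx', e, e']

/-- Angular eigenvalues are invariant under `(a, m) ↦ (−a, −m)` (Teukolsky form).
[cite: Hatsuda2020, (2.5)] -/
theorem isAngularEigenvalue_neg_iff (a Λ s : ℝ) (ω : ℂ) (m : ℝ) (lam : ℂ) :
    IsAngularEigenvalue (-a) Λ s ω (-m) lam ↔ IsAngularEigenvalue a Λ s ω m lam := by
  have key : ∀ (a m : ℝ), IsAngularEigenvalue a Λ s ω m lam →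
      IsAngularEigenvalue (-a) Λ s ω (-m) lam := by
    rintro a m ⟨S, hS, hreg, x, hx, hSx⟩
    exact ⟨fun y => S (-y), isAngularTeukolskySolution_reflect hS, isRegularAtPoles_reflect hreg,
      -x, ⟨by linarith [hx.2], by linarith [hx.1]⟩, by simpa using hSx⟩
  constructor
  · intro h
    simpa using key (-a) (-m) h
  · exact key a m

/-- Master angular eigenvalues are invariant under `(a, ν, m) ↦ (−a, −ν, −m)`.
[cite: CasalsTeixeiradacosta2022, (3.6)] -/
theorem isMasterAngularEigenvalue_neg_iff (a Λ s μ : ℝ) (ν : ℂ) (m : ℝ) (lamBar : ℂ) :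
    IsMasterAngularEigenvalue (-a) Λ s μ (-ν) (-m) lamBar ↔
      IsMasterAngularEigenvalue a Λ s μ ν m lamBar := by
  have key : ∀ (a : ℝ) (ν : ℂ) (m : ℝ), IsMasterAngularEigenvalue a Λ s μ ν m lamBar →
      IsMasterAngularEigenvalue (-a) Λ s μ (-ν) (-m) lamBar := by
    rintro a ν m ⟨S, hS, hreg, x, hx, hSx⟩
    exact ⟨fun y => S (-y), isMasterAngularSolution_reflect hS, isRegularAtPoles_reflect hreg,
      -x, ⟨by linarith [hx.2], by linarith [hx.1]⟩, by simpa using hSx⟩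
  constructor
  · intro h
    simpa using key (-a) (-ν) (-m) h
  · exact key a ν m

/-! ### Modes and mode stability -/

/-- **`HasMode M (−a) Λ s ω (−m) ↔ HasMode M a Λ s ω m`**: a Teukolsky mode for the reversed rotation
and azimuthal number is the same radial function with the reflected angular function.
[cite: CasalsTeixeiradacosta2022, Definition 3.4] -/
theorem hasMode_neg_iff (M a Λ s : ℝ) (ω : ℂ) (m : ℝ) :
    HasMode M (-a) Λ s ω (-m) ↔ HasMode M a Λ s ω m := by
  simp only [HasMode, IsModeSolution, isAngularEigenvalue_neg_iff, isRadialTeukolskySolution_neg_iff,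
    isIngoingAtEventHorizon_neg_iff, isOutgoingAtCosmoHorizon_neg_iff, rPlus_neg, rCosmo_neg]

/-- **`HasMasterMode M (−a) Λ s μ ω (−m) ↔ HasMasterMode M a Λ s μ ω m`** (any `μ`).
[cite: CasalsTeixeiradacosta2022, Definition 3.4] -/
theorem hasMasterMode_neg_iff (M a Λ s μ : ℝ) (ω : ℂ) (m : ℝ) :
    HasMasterMode M (-a) Λ s μ ω (-m) ↔ HasMasterMode M a Λ s μ ω m := by
  have hν : ((-a : ℝ) : ℂ) * ω = -((a : ℂ) * ω) := by push_cast; ring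
  simp only [HasMasterMode, IsMasterModeSolution, hν, isMasterAngularEigenvalue_neg_iff,
    isMasterRadialSolution_neg_iff, isIngoingAtEventHorizon_neg_iff, isOutgoingAtCosmoHorizon_neg_iff,
    rPlus_neg, rCosmo_neg]

/-- Admissibility `m − s ∈ ℤ` is reflection invariant when `2s ∈ ℤ`. [cite: CasalsTeixeiradacosta2022, Definition 3.4] -/
theorem admissible_neg_iff {s : ℝ} (hs : ∃ k : ℤ, 2 * s = k) (m : ℝ) :
    (∃ k : ℤ, -m - s = k) ↔ ∃ k : ℤ, m - s = k := by
  obtain ⟨k₂, hk₂⟩ := hs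
  constructor
  · rintro ⟨k, hk⟩
    exact ⟨-k - k₂, by push_cast; linarith⟩
  · rintro ⟨k, hk⟩
    exact ⟨-k - k₂, by push_cast; linarith⟩

/-- **No-mode windows reflect in `m`**: `NoModeIn M (−a) Λ s W ↔ NoModeIn M a Λ s {(ω, m) | (ω, −m) ∈ W}`
for `2s ∈ ℤ`. [cite: CasalsTeixeiradacosta2022, Definition 3.4] -/
theorem noModeIn_neg_iff (M a Λ : ℝ) {s : ℝ} (hs : ∃ k : ℤ, 2 * s = k) (W : Set (ℂ × ℝ)) :
    NoModeIn M (-a) Λ s W ↔ NoModeIn M a Λ s {p | (p.1, -p.2) ∈ W} := by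
  constructor
  · intro h ω m hW hm
    have h' := h ω (-m) hW ((admissible_neg_iff hs m).2 hm)
    rwa [hasMode_neg_iff] at h'
  · intro h ω m hW hm
    have hW' : (ω, -m) ∈ {p : ℂ × ℝ | (p.1, -p.2) ∈ W} := by simpa using hW
    have hm' : ∃ k : ℤ, -m - s = k := by
      obtain ⟨k, hk⟩ := hm
      obtain ⟨k₂, hk₂⟩ := hs
      exact ⟨-k - k₂, by push_cast; linarith⟩
    have h' := h ω (-m) hW' hm'
    rwa [← hasMode_neg_iff, neg_neg] at h'

/-- ★ **Mode stability is insensitive to the sense of rotation**: for `2s ∈ ℤ`,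
`ModeStable M (−a) Λ s ↔ ModeStable M a Λ s`. [cite: CasalsTeixeiradacosta2022, Definition 3.4] -/
theorem modeStable_neg_iff (M a Λ : ℝ) {s : ℝ} (hs : ∃ k : ℤ, 2 * s = k) :
    ModeStable M (-a) Λ s ↔ ModeStable M a Λ s := by
  unfold ModeStable
  rw [noModeIn_neg_iff M a Λ hs]
  simp [unstableWindow]

/-- The master-system version (any `μ`): `MasterModeStable M (−a) Λ s μ ↔ MasterModeStable M a Λ s μ`
for `2s ∈ ℤ`. [cite: CasalsTeixeiradacosta2022, Definition 3.4] -/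
theorem masterModeStable_neg_iff (M a Λ : ℝ) {s : ℝ} (μ : ℝ) (hs : ∃ k : ℤ, 2 * s = k) :
    MasterModeStable M (-a) Λ s μ ↔ MasterModeStable M a Λ s μ := by
  have key : ∀ a : ℝ, MasterModeStable M a Λ s μ → MasterModeStable M (-a) Λ s μ := by
    intro a h ω m hW hm hmode
    have hm' : ∃ k : ℤ, -m - s = k := by
      obtain ⟨k, hk⟩ := hm
      obtain ⟨k₂, hk₂⟩ := hs
      exact ⟨-k - k₂, by push_cast; linarith⟩
    have := h ω (-m) hW hm'
    rw [← hasMasterMode_neg_iff, neg_neg] at this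
    exact this hmode
  constructor
  · intro h
    simpa using key (-a) h
  · exact key a

/-- Mode stability on a parameter box transfers to the box with `a ↦ −a` (`2s ∈ ℤ`).
[cite: CasalsTeixeiradacosta2022, Definition 3.4] -/
theorem modeStableOn_neg {B : Set (ℝ × ℝ × ℝ)} {s : ℝ} (hs : ∃ k : ℤ, 2 * s = k)
    (h : ModeStableOn B s) : ModeStableOn {p | (p.1, -p.2.1, p.2.2) ∈ B} s := by
  rintro ⟨M, a, Λ⟩ hp
  have hp' : (M, -a, Λ) ∈ B := hp
  have h1 := h (M, -a, Λ) hp'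
  dsimp only at h1 ⊢
  exact (modeStable_neg_iff M a Λ hs).1 h1

end Literature.Geometry.Lorentzian.KerrDeSitter

end
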